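import Summits.ValiantsHypothesis.ValiantsHypothesis.Theorems.PolyaContinuedSignedCoverLittleEarB
import Mathlib.Algebra.Ring.Parity
import HarnessLib

/-!
# Route PolyaContinued — support item `SignedCoverLittle` (stmt-ValiantsHypothesis-7426):
# ear lemma, part C — forks of two circuits, single-ear circuits, and the Case-B structure

Continues `…EarA.lean` / `…EarB.lean` (cyclic distance `cdist`, directed paths `pathSet`, the
splice `exists_splice_cycle`). This file is step (EAR) of the paper proof `proof-LabelTransfer.md`
(§2) of the label-transfer principle, as pure permutation combinatorics on a finite type: two
cyclic permutations `μ, ν` ("dicircuits" `γ₊, γ₋`) are compared along their FORKS.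

* `forks μ ν` — the points moved by both `μ` and `ν` at which they disagree (the ends of the
  common directed paths; `#forks = |Vm| − |Cm|` in the notation of the paper proof);
* `odd_card_forks` — **parity**: if `μ`, `ν` and `μ⁻¹ ν` are cyclic then `#forks μ ν` is odd (sign
  arithmetic: `#supp (μ⁻¹ν) + 2 #(common arcs) + #forks = #supp μ + #supp ν`);
* `mem_pathSet_rotate`, `mem_pathSet_iff_le_and_lt`, `mem_pathSet_iff_le` — cyclic-order
  bookkeeping on one circuit (rotation of a cyclic triple; the three arcs cut out by a cyclic
  triple partition the support);
* `disjoint_pathSet_of_forks` — two CONSECUTIVE forks `p, p'` of `μ` (no fork strictly between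
  them along `μ`) are spliceable: the `μ`-path from `p` to `p'` and the `ν`-path from `p'` back to
  `p` are disjoint (`apply_eq_of_mem_pathSet_of_forks`: between forks the two circuits run
  together). The sequel `…EarD.lean` splices them into the single-ear circuits, proves the fork
  injection `#forks + 2 ≤ #(dicircuits)` and derives the Case-B structure.

No graph appears: in the application (the closer of the item) `μ, ν` are the lifts `γ₊, γ₋` of
the two long dicircuits of the Little obstruction to the Pfaffian source graph `H₁` in normal form.
-/

namespace Summit.ValiantsHypothesis.PolyaContinued

open Equiv Equiv.Perm Finset

variable {α : Type*} [Fintype α] [DecidableEq α]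

/-! ### Forks -/

/-- **Forks** of two permutations `μ, ν`: the points moved by both at which they disagree. For two
directed circuits these are the last vertices of the maximal common directed paths, so that
`#forks μ ν = |V(μ) ∩ V(ν)| − |arcs(μ) ∩ arcs(ν)|`. [folklore] -/
def forks (μ ν : Perm α) : Finset α :=
  (μ.support ∩ ν.support).filter fun x => μ x ≠ ν x

/-- Membership in `forks`. [folklore] -/
theorem mem_forks {μ ν : Perm α} {x : α} :
    x ∈ forks μ ν ↔ μ x ≠ x ∧ ν x ≠ x ∧ μ x ≠ ν x := by
  simp only [forks, mem_filter, mem_inter, mem_support, and_assoc]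

/-- Forks are symmetric in the two permutations. [folklore] -/
theorem forks_comm (μ ν : Perm α) : forks μ ν = forks ν μ := by
  ext x
  simp only [mem_forks]
  exact ⟨fun ⟨h1, h2, h3⟩ => ⟨h2, h1, Ne.symm h3⟩, fun ⟨h1, h2, h3⟩ => ⟨h2, h1, Ne.symm h3⟩⟩

/-- A fork lies in both supports. [folklore] -/
theorem mem_support_of_mem_forks_left {μ ν : Perm α} {x : α} (h : x ∈ forks μ ν) :
    x ∈ μ.support :=
  mem_support.2 (mem_forks.1 h).1

/-- A fork lies in both supports. [folklore] -/
theorem mem_support_of_mem_forks_right {μ ν : Perm α} {x : α} (h : x ∈ forks μ ν) :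
    x ∈ ν.support :=
  mem_support.2 (mem_forks.1 h).2.1

/-- Two permutations with a fork are distinct. [folklore] -/
theorem ne_of_mem_forks {μ ν : Perm α} {x : α} (h : x ∈ forks μ ν) : μ ≠ ν :=
  fun e => (mem_forks.1 h).2.2 (by rw [e])

/-! ### Parity of the number of forks -/

/-- The support of `μ⁻¹ * ν` is the set of points where `μ` and `ν` disagree. [folklore] -/
theorem mem_support_inv_mul_iff {μ ν : Perm α} {x : α} : x ∈ (μ⁻¹ * ν).support ↔ μ x ≠ ν x := by
  rw [mem_support, Perm.mul_apply, Ne, Perm.inv_eq_iff_eq]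
  exact ⟨fun h h' => h h'.symm, fun h h' => h h'.symm⟩

/-- Counting the points where two permutations disagree:
`#supp (μ⁻¹ν) + 2 · #(common arcs) + … `, precisely
`#supp (μ⁻¹ * ν) + 2 · #{x ∈ supp μ ∩ supp ν | μ x = ν x} + #forks μ ν = #supp μ + #supp ν`.
[folklore] -/
theorem card_support_inv_mul_add (μ ν : Perm α) :
    (μ⁻¹ * ν).support.card + 2 * ((μ.support ∩ ν.support).filter fun x => μ x = ν x).card +
      (forks μ ν).card = μ.support.card + ν.support.card := by
  set C := (μ.support ∩ ν.support).filter fun x => μ x = ν x with hC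
  -- `forks` and `C` partition `supp μ ∩ supp ν`
  have h1 : C.card + (forks μ ν).card = (μ.support ∩ ν.support).card := by
    rw [hC, forks]
    exact Finset.card_filter_add_card_filter_not (s := μ.support ∩ ν.support) (fun x => μ x = ν x)
  -- `supp (μ⁻¹ν)` and `C` partition `supp μ ∪ supp ν`
  have h2 : (μ⁻¹ * ν).support.card + C.card = (μ.support ∪ ν.support).card := by
    rw [← Finset.card_union_of_disjoint]
    · congr 1
      ext x
      rw [mem_union, mem_union, mem_support_inv_mul_iff, hC, mem_filter, mem_inter, mem_support,
        mem_support]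
      constructor
      · rintro (h | ⟨⟨h, -⟩, -⟩)
        · by_contra hx
          push Not at hx
          apply h
          rw [hx.1, hx.2]
        · exact Or.inl h
      · intro h
        by_cases hd : μ x = ν x
        · right
          rcases h with h | h
          · exact ⟨⟨h, by rwa [← hd]⟩, hd⟩
          · exact ⟨⟨by rwa [hd], h⟩, hd⟩
        · exact Or.inl hd
    · rw [Finset.disjoint_left]
      intro x hx hx'
      rw [mem_support_inv_mul_iff] at hx
      exact hx (mem_filter.1 hx').2
  have h3 := Finset.card_union_add_card_inter μ.support ν.support
  omega

/-- Parities of exponents of `-1` agree when the powers do (in `ℤˣ`). [folklore] -/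
theorem even_iff_even_of_neg_one_pow_eq {m k : ℕ} (h : (-1 : ℤˣ) ^ m = (-1) ^ k) :
    (Even m ↔ Even k) := by
  rcases Nat.even_or_odd m with hm | hm <;> rcases Nat.even_or_odd k with hk | hk
  · exact iff_of_true hm hk
  · rw [hm.neg_one_pow, hk.neg_one_pow] at h; exact absurd h (by decide)
  · rw [hm.neg_one_pow, hk.neg_one_pow] at h; exact absurd h (by decide)
  · exact iff_of_false (Nat.not_even_iff_odd.2 hm) (Nat.not_even_iff_odd.2 hk)

/-- **Parity of forks.** If `μ`, `ν` and `μ⁻¹ * ν` are cyclic permutations (two directed circuits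
whose symmetric difference is a single alternating circuit), the number of forks is ODD.
Proof: `sign (μ⁻¹ν) = sign μ · sign ν` with `sign c = -(-1)^{#supp c}` for a cycle `c`, and
`#supp (μ⁻¹ν) ≡ #supp μ + #supp ν + #forks (mod 2)` (`card_support_inv_mul_add`). [folklore] -/
theorem odd_card_forks {μ ν : Perm α} (hμ : μ.IsCycle) (hν : ν.IsCycle)
    (h : (μ⁻¹ * ν).IsCycle) : Odd (forks μ ν).card := by
  have hs : Perm.sign (μ⁻¹ * ν) = Perm.sign μ * Perm.sign ν := by
    rw [Perm.sign_mul, Perm.sign_inv]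
  rw [h.sign, hμ.sign, hν.sign, neg_mul_neg, ← pow_add] at hs
  -- `-(-1)^s = (-1)^(a+b)`, i.e. `(-1)^(s+1) = (-1)^(a+b)`
  have hs' : (-1 : ℤˣ) ^ ((μ⁻¹ * ν).support.card + 1) =
      (-1) ^ (μ.support.card + ν.support.card) := by
    rw [pow_succ, mul_neg_one, hs]
  have hpar := even_iff_even_of_neg_one_pow_eq hs'
  have hcount := card_support_inv_mul_add μ ν
  rw [Nat.even_iff, Nat.even_iff] at hpar
  rw [Nat.odd_iff]
  omega

/-! ### Cyclic order on one circuit -/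

/-- **Rotation of a cyclic triple**: if, starting from `x`, the circuit `σ` meets `a` before `b`,
then starting from `a` it meets `b` before `x`. [folklore] -/
theorem mem_pathSet_rotate {σ : Perm α} (hσ : σ.IsCycle) {x a b : α} (hx : x ∈ σ.support)
    (ha : a ∈ σ.support) (hb : b ∈ σ.support) (hxa : x ≠ a) (h : a ∈ pathSet σ x b) :
    b ∈ pathSet σ a x := by
  obtain ⟨-, hlt⟩ := mem_pathSet.1 h
  have hadd := cdist_add hσ hx ha hb hlt.le
  have hrev := cdist_add_cdist_rev hσ hx ha hxa
  have hbo := cdist_lt_orderOf hσ hx hb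
  exact mem_pathSet.2 ⟨hb, by omega⟩

/-- The middle arc of a cyclic triple `a → b → c`: a point `v` of the support lies on the path
from `b` to `c` iff its distance from `a` is in `[cdist a b, cdist a c)`. [folklore] -/
theorem mem_pathSet_iff_le_and_lt {σ : Perm α} (hσ : σ.IsCycle) {a b c v : α}
    (ha : a ∈ σ.support) (hb : b ∈ σ.support) (hc : c ∈ σ.support) (hv : v ∈ σ.support)
    (hbc : b ∈ pathSet σ a c) :
    v ∈ pathSet σ b c ↔ cdist σ a b ≤ cdist σ a v ∧ cdist σ a v < cdist σ a c := by
  obtain ⟨-, hblt⟩ := mem_pathSet.1 hbc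
  have hac := cdist_add hσ ha hb hc hblt.le     -- cdist a c = cdist a b + cdist b c
  have hco := cdist_lt_orderOf hσ ha hc
  constructor
  · intro h
    obtain ⟨-, hvlt⟩ := mem_pathSet.1 h
    -- `(σ ^ (cdist a b + cdist b v)) a = v`, below the order, so it is `cdist a v`
    have key : (σ ^ (cdist σ a b + cdist σ b v)) a = v := by
      rw [add_comm, pow_add, Perm.mul_apply, pow_cdist_apply_of_mem hσ ha hb,
        pow_cdist_apply_of_mem hσ hb hv]
    have hav := cdist_eq_of_pow_apply hσ ha (by omega) key
    omega
  · rintro ⟨hle, hlt⟩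
    have hav := cdist_add hσ ha hb hv hle       -- cdist a v = cdist a b + cdist b v
    exact mem_pathSet.2 ⟨hv, by omega⟩

/-- The last arc of a cyclic triple: for `a ≠ c`, a point `v` of the support lies on the path from
`c` back to `a` iff `cdist a c ≤ cdist a v`. [folklore] -/
theorem mem_pathSet_iff_le {σ : Perm α} (hσ : σ.IsCycle) {a c v : α} (ha : a ∈ σ.support)
    (hc : c ∈ σ.support) (hv : v ∈ σ.support) (hac : a ≠ c) :
    v ∈ pathSet σ c a ↔ cdist σ a c ≤ cdist σ a v := by
  have hrev := cdist_add_cdist_rev hσ ha hc hac  -- cdist a c + cdist c a = orderOf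
  have hvo := cdist_lt_orderOf hσ ha hv
  constructor
  · intro h
    obtain ⟨-, hvlt⟩ := mem_pathSet.1 h
    have key : (σ ^ (cdist σ a c + cdist σ c v)) a = v := by
      rw [add_comm, pow_add, Perm.mul_apply, pow_cdist_apply_of_mem hσ ha hc,
        pow_cdist_apply_of_mem hσ hc hv]
    have hav := cdist_eq_of_pow_apply hσ ha (by omega) key
    omega
  · intro hle
    have hav := cdist_add hσ ha hc hv hle
    exact mem_pathSet.2 ⟨hv, by omega⟩

/-- **The three arcs of a cyclic triple partition the circuit**: for `a → b → c` in cyclic order on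
`σ`, every point of the support lies on exactly one of the paths `a → b`, `b → c`, `c → a` — here
the covering statement. [folklore] -/
theorem mem_pathSet_or_of_mem_support {σ : Perm α} (hσ : σ.IsCycle) {a b c v : α}
    (ha : a ∈ σ.support) (hb : b ∈ σ.support) (hc : c ∈ σ.support) (hv : v ∈ σ.support)
    (hbc : b ∈ pathSet σ a c) :
    v ∈ pathSet σ a b ∨ v ∈ pathSet σ b c ∨ v ∈ pathSet σ c a := by
  have hac : a ≠ c := by
    rintro rfl; have := (mem_pathSet.1 hbc).2; rw [cdist_self] at this; omega
  by_cases h1 : cdist σ a v < cdist σ a b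
  · exact Or.inl (mem_pathSet.2 ⟨hv, h1⟩)
  by_cases h2 : cdist σ a v < cdist σ a c
  · exact Or.inr (Or.inl ((mem_pathSet_iff_le_and_lt hσ ha hb hc hv hbc).2 ⟨by omega, h2⟩))
  · exact Or.inr (Or.inr ((mem_pathSet_iff_le hσ ha hc hv hac).2 (by omega)))

/-- The three arcs of a cyclic triple are pairwise disjoint (first and second). [folklore] -/
theorem disjoint_pathSet_fst_snd {σ : Perm α} (hσ : σ.IsCycle) {a b c : α}
    (ha : a ∈ σ.support) (hb : b ∈ σ.support) (hc : c ∈ σ.support) (hbc : b ∈ pathSet σ a c) :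
    Disjoint (pathSet σ a b) (pathSet σ b c) := by
  rw [Finset.disjoint_left]
  intro v hv1 hv2
  obtain ⟨hv, hlt⟩ := mem_pathSet.1 hv1
  have := (mem_pathSet_iff_le_and_lt hσ ha hb hc hv hbc).1 hv2
  omega

/-- The three arcs of a cyclic triple are pairwise disjoint (second and third). [folklore] -/
theorem disjoint_pathSet_snd_thd {σ : Perm α} (hσ : σ.IsCycle) {a b c : α}
    (ha : a ∈ σ.support) (hb : b ∈ σ.support) (hc : c ∈ σ.support) (hbc : b ∈ pathSet σ a c) :
    Disjoint (pathSet σ b c) (pathSet σ c a) := by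
  have hac : a ≠ c := by
    rintro rfl; have := (mem_pathSet.1 hbc).2; rw [cdist_self] at this; omega
  rw [Finset.disjoint_left]
  intro v hv1 hv2
  have hv := mem_support_of_mem_pathSet hv1
  have h1 := (mem_pathSet_iff_le_and_lt hσ ha hb hc hv hbc).1 hv1
  have h2 := (mem_pathSet_iff_le hσ ha hc hv hac).1 hv2
  omega

/-- The three arcs of a cyclic triple are pairwise disjoint (third and first). [folklore] -/
theorem disjoint_pathSet_thd_fst {σ : Perm α} (hσ : σ.IsCycle) {a b c : α}
    (ha : a ∈ σ.support) (hc : c ∈ σ.support) (hbc : b ∈ pathSet σ a c) :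
    Disjoint (pathSet σ c a) (pathSet σ a b) := by
  have hac : a ≠ c := by
    rintro rfl; have := (mem_pathSet.1 hbc).2; rw [cdist_self] at this; omega
  rw [Finset.disjoint_left]
  intro v hv1 hv2
  have hv := mem_support_of_mem_pathSet hv1
  have h1 := (mem_pathSet_iff_le hσ ha hc hv hac).1 hv1
  obtain ⟨-, h2⟩ := mem_pathSet.1 hv2
  obtain ⟨-, h3⟩ := mem_pathSet.1 hbc
  omega

/-! ### Consecutive forks are spliceable -/

/-- **Between forks, the two circuits run together.** Let `p, p'` be forks with no fork on the
`μ`-path from `p` to `p'` other than `p` itself, and let `v ≠ p` be a point of that path moved by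
`ν`. Then every point `w` of the `μ`-path from `v` to `p'` is moved by `ν`, and `μ w = ν w`.
[folklore] -/
theorem apply_eq_of_mem_pathSet_of_forks {μ ν : Perm α} (hμ : μ.IsCycle) {p p' v : α}
    (hp : p ∈ forks μ ν) (hp' : p' ∈ forks μ ν)
    (hno : ∀ x ∈ forks μ ν, x ∈ pathSet μ p p' → x = p)
    (hv : v ∈ pathSet μ p p') (hvp : v ≠ p) (hvν : v ∈ ν.support) :
    ∀ w ∈ pathSet μ v p', w ∈ ν.support ∧ μ w = ν w := by
  have hpμ := mem_support_of_mem_forks_left hp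
  have hp'μ := mem_support_of_mem_forks_left hp'
  have hvμ := mem_support_of_mem_pathSet hv
  have hpp' : p ≠ p' := by
    rintro rfl; have := (mem_pathSet.1 hv).2; rw [cdist_self] at this; omega
  -- `p` is not on the `μ`-path from `v` to `p'`, which lies inside the path from `p` to `p'`
  have hpv : p ∉ pathSet μ v p' := by
    have h1 : p' ∈ pathSet μ v p := mem_pathSet_rotate hμ hpμ hvμ hp'μ (Ne.symm hvp) hv
    exact (mem_pathSet_iff_notMem_pathSet hμ hvμ hp'μ hpμ (Ne.symm hpp')).1 h1
  have hsub : pathSet μ v p' ⊆ pathSet μ p p' := pathSet_subset_of_mem hμ hpμ hp'μ hv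
  refine pathSet_induction hμ hvμ (Q := fun w => w ∈ ν.support ∧ μ w = ν w) ?_ ?_
  · intro _
    refine ⟨hvν, ?_⟩
    by_contra hne
    exact hvp (hno v (mem_forks.2 ⟨mem_support.1 hvμ, mem_support.1 hvν, hne⟩) hv)
  · rintro w hw hμw ⟨hwν, hweq⟩
    have hμwν : μ w ∈ ν.support := by rw [hweq]; exact apply_mem_support.2 hwν
    refine ⟨hμwν, ?_⟩
    by_contra hne
    have hfork : μ w ∈ forks μ ν :=
      mem_forks.2 ⟨mem_support.1 (apply_mem_support.2 (mem_support_of_mem_pathSet hw)),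
        mem_support.1 hμwν, hne⟩
    exact hpv ((hno (μ w) hfork (hsub hμw)) ▸ hμw)

/-- **Consecutive forks are spliceable.** If `p, p'` are forks of `μ, ν` with no fork on the
`μ`-path from `p` to `p'` other than `p`, then the `μ`-path from `p` to `p'` and the `ν`-path from
`p'` back to `p` have no tail in common. (A common tail `v` would be a non-fork common point; from
`v` the two circuits run together up to `p'`, so `ν` reaches `p'` from `v` before `p`, i.e. `v`
lies on the `ν`-path from `p` to `p'`, not on the one from `p'` to `p`.) [folklore] -/
theorem disjoint_pathSet_of_forks {μ ν : Perm α} (hμ : μ.IsCycle) (hν : ν.IsCycle) {p p' : α}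
    (hp : p ∈ forks μ ν) (hp' : p' ∈ forks μ ν)
    (hno : ∀ x ∈ forks μ ν, x ∈ pathSet μ p p' → x = p) :
    Disjoint (pathSet μ p p') (pathSet ν p' p) := by
  have hpμ := mem_support_of_mem_forks_left hp
  have hp'μ := mem_support_of_mem_forks_left hp'
  have hpν := mem_support_of_mem_forks_right hp
  have hp'ν := mem_support_of_mem_forks_right hp'
  rw [Finset.disjoint_left]
  intro v hvμ hvν
  have hvνs := mem_support_of_mem_pathSet hvν
  have hvμs := mem_support_of_mem_pathSet hvμ
  have hpp' : p ≠ p' := by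
    rintro rfl; have := (mem_pathSet.1 hvμ).2; rw [cdist_self] at this; omega
  have hvp : v ≠ p := fun h => notMem_pathSet_end ν p' p (h ▸ hvν)
  have hvp' : v ≠ p' := fun h => notMem_pathSet_end μ p p' (h ▸ hvμ)
  have hQ := apply_eq_of_mem_pathSet_of_forks hμ hp hp' hno hvμ hvp hvνs
  -- the powers of `ν` and `μ` agree at `v` up to `d = cdist μ v p'`
  set d := cdist μ v p' with hd
  have hpow : ∀ k, k ≤ d → (ν ^ k) v = (μ ^ k) v := by
    intro k
    induction k with
    | zero => intro; rfl
    | succ k ih =>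
      intro hk
      have hk' : k < d := hk
      have hmem : (μ ^ k) v ∈ pathSet μ v p' :=
        (mem_pathSet_iff_exists_pow hμ hvμs hp'μ).2 ⟨k, hk', rfl⟩
      rw [pow_succ', Perm.mul_apply, ih hk'.le, pow_succ', Perm.mul_apply]
      exact ((hQ _ hmem).2).symm
  have hνd : (ν ^ d) v = p' := by rw [hpow d le_rfl, hd, pow_cdist_apply_of_mem hμ hvμs hp'μ]
  have hcd : cdist ν v p' ≤ d := cdist_le_of_pow_apply hνd
  -- `p` is not on the `ν`-path from `v` to `p'` (that path is the `μ`-path, which avoids `p`)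
  have hpν' : p ∉ pathSet ν v p' := by
    intro h
    obtain ⟨k, hk, hkp⟩ := (mem_pathSet_iff_exists_pow hν hvνs hp'ν).1 h
    have hk' : k < d := lt_of_lt_of_le hk hcd
    rw [hpow k hk'.le] at hkp
    have hmem : (μ ^ k) v ∈ pathSet μ v p' :=
      (mem_pathSet_iff_exists_pow hμ hvμs hp'μ).2 ⟨k, hk', rfl⟩
    rw [hkp] at hmem
    have h1 : p' ∈ pathSet μ v p := mem_pathSet_rotate hμ hpμ hvμs hp'μ hvp.symm hvμ
    exact (mem_pathSet_iff_notMem_pathSet hμ hvμs hp'μ hpμ hpp'.symm).1 h1 hmem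
  -- hence `ν` meets `p'` before `p` starting from `v`; rotate and conclude
  have h2 : p' ∈ pathSet ν v p :=
    (mem_pathSet_iff_notMem_pathSet hν hvνs hp'ν hpν hpp'.symm).2 hpν'
  have h3 : p ∈ pathSet ν p' v := mem_pathSet_rotate hν hvνs hp'ν hpν hvp' h2
  exact (mem_pathSet_iff_notMem_pathSet hν hp'ν hpν hvνs hvp.symm).1 h3 hvν

end Summit.ValiantsHypothesis.PolyaContinued
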